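import Summits.BirchSwinnertonDyer.BirchSwinnertonDyer.Theorems.AdditiveKolyvaginRoadLevelKolyvaginSystemsAdditiveGammaLocusKPA
import Summits.BirchSwinnertonDyer.BirchSwinnertonDyer.Theorems.AdditiveKolyvaginRoadSignAgreementOfTorsionCongr
import HarnessLib

/-!
# Route `AdditiveKolyvaginRoad`, cruxes KS′ `LevelKolyvaginSystemsAdditive` (item stmt-BirchSwinnertonDyer-21396) and
# KPA′ `KolyvaginPrimitiveAdditive` (item stmt-BirchSwinnertonDyer-21400):
# THE SELF-CERTIFICATE DOOR — line `epsilon_matched_retyping`'s certificate asked of `E` itself, with NO named fact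
# (cell `pub/bsd-wall`, width seat `bsd-wall-akr-p2x-w2` g7; `--supports stmt-BirchSwinnertonDyer-21396`, helper; part 1 of 2, part 2 =
# `…KolyvaginPrimitiveAboveBottom`)

WHY.  The registered skeleton v12 of line `epsilon_matched_retyping` (`Cruxes/LevelKolyvaginSystemsAdditive/Lines/epsilon_matched_retyping.lean`,
sha16 31a1d0c9a47cd08f) closes KS′ from two stubs: S1″ = the conclusion of KPA′ at the ♯ frames OFF the slim good-avatar locus, and S0′ =
Kriz–Li 2019 Thm. 1.16 ∧ PUB ∧ DUAL.  ON the locus the frame carries a `p`-good non-anomalous rational avatar `E₀` with `E[p] ≃ E₀[p]` and a LOG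
CERTIFICATE «a Heegner point `y₀` of `E₀` is not `p`-divisible in `E₀(ℚ_p)` along `ιp`», and Kriz–Li's congruence of `p`-adic logarithms transports
that certificate to `E`, where it yields `c_E(1) ≠ 0` (w3 p605382, lead p629856, g4 p633401).  THIS FILE records two facts about that mechanism:

(A) THE SELF-CERTIFICATE DOOR (§§1–2, NO named fact).  The SAME certificate shape, asked of `E` ITSELF — «some Heegner point `y` of `E` over
    `heegnerPointComplex Dt H` with the frame's orientation (`β(H) = β`) is not `p`-divisible in `E(ℚ_p)` along some `ιp`» — gives `c_E(1) ≠ 0` for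
    EVERY conductor-one Kolyvagin–Heegner datum on the frame, hence KPA′'s conclusion at the frame with `n = 1`: local non-divisibility ⟹ global
    non-divisibility ⟹ `c(1) ≠ 0` (McCallum 1991 Cor. 4.5 + Lemma 5.1 with Gross's Lemma 4.3 ∕ Prop. 3.6 supplied — the tree's
    `kolyvaginClass_one_ne_zero_iff_not_exists_zsmul_eq`; the one new step is §1: a Heegner point given BY an oriented Heegner datum maps to `P(1)`
    of every conductor-one datum, by Shimura reciprocity at conductor one — `heegnerPointOfConductor_one_galoisConj_holds`, PROVED in the tree — and
    the injectivity of `E(K) → E(ℂ)`).  The GLOBAL certificate «`y ∉ p·E(K)`» is EQUIVALENT to `c(1) ≠ 0` (§1); the local one and its valuation form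
    `ord_p log_ω y ≤ 0` (§2, additive `p ≥ 5`) are the computable sufficient conditions:
    `ord_p log_ω y ≤ 0 ⟹ y ∉ p·E(ℚ_p) ⟹ y ∉ p·E(K) ⟺ c(1) ≠ 0`.
(B) THE AVATAR DOOR OPENS NO FRAME THE BOTTOM CLASS DOES NOT (§3, Kriz–Li BY NAME).  Kriz–Li's valuation corollary is an `iff` between the two
    curves, so the avatar's certificate, transported, IS the self-certificate in valuation form; in the tree: slim good-avatar locus ∧ KL 1.16 ⟹ the
    global self-certificate for EVERY oriented Heegner point of `E` (`heegnerPoint_not_pDiv_on_goodAvatarLocus_of_thm116`, a repackaging of w3's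
    `kolyvaginClass_one_ne_zero_of_thm116_of_lossless`).  So v12's covered locus ⊆ {frames with `c(1) ≠ 0`} — the frames the bottom class certifies
    BY ITSELF, modulo nothing.  Part 2 draws the consequence for the line: the canonical residual «Kolyvagin's conjecture mod `p` ABOVE THE BOTTOM»
    and a skeleton without Kriz–Li.

WHAT:
* §1 `map_algebraMap_eq_derivedPoint_of_heegnerPoint` (oriented Heegner point ↦ `P(1)` of every conductor-one datum);
  `kolyvaginClass_one_ne_zero_iff_heegnerPoint_not_pDiv` (`c(1) ≠ 0 ↔ y ∉ p·E(K)` for such `y`).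
* §2 `not_exists_zsmul_eq_of_selfCertificate` (local ⟹ global non-divisibility); `selfCertificate_of_padicLogOrd_le_zero` (valuation form ⟹ local
  form at an additive `p ≥ 5`, `y` of infinite order); `kolyvaginClass_one_ne_zero_of_selfCertificate` (THE DOOR);
  `kolyvaginPrimitiveAdditive_conclusion_of_selfCertificate` (KPA′'s binders VERBATIM + the self-certificate ⟹ KPA′'s conclusion, `n = 1`);
  `kolyvaginPrimitiveAdditive_conclusion_of_bottom` (`∃ d₁, c(1) ≠ 0` ⟹ KPA′'s conclusion — the trivial door).
* §3 `heegnerPoint_not_pDiv_on_goodAvatarLocus_of_thm116` (KL ∧ slim good-avatar locus ⟹ global self-certificate, every oriented Heegner point).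

HONEST FRAMING: theorems only; 0 definitions, 0 named facts introduced, 0 `sorry`.  §§1–2 use NO named fact; §3 is conditional on
`KrizLi2019.thm116_padicLogHeegner_congruence` BY NAME.  Nothing here proves Kolyvagin's conjecture at a frame that carries no certificate; the theorems
are certificate DOORS (per-frame, decidable hypotheses displayed as binders), not coverage claims.  Closes nothing.  BSD is not proved by any of this;
KS′ and KPA′ remain OPEN at `p² ∣ N`; no summit statement is proved by this file.

References: [cite: McCallumLMS1991, §4 (4)–(6), Cor. 4.5, §5 Lemma 5.1] [cite: GrossLMS1991, Lemma 4.3, Prop. 3.6, §4 (4.1), (4.4) (P_1 = y_K)]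
[cite: Darmon2004, Thm. 3.6, Thm. 3.7] [cite: KrizLi2019, Thm. 1.16, Rem. 1.17 and the sentence after Rem. 1.19] [cite: SilvermanAEC2009, IV.6.4, VII.6.3]
[cite: Kim2022StructureSelmer, Lemma 3.10] [cite: DarmonDiamondTaylor1995, Prop. 2.12 (c)].
-/
set_option linter.dupNamespace false -- single-conjunct summit repeats the name by design

noncomputable section

open scoped Classical

namespace Summit.BirchSwinnertonDyer.BirchSwinnertonDyer.Theorems.AdditiveKoly

open WeierstrassCurve NumberField IsDedekindDomain Field
  Literature.NumberTheory.EllipticCurves Literature.NumberTheory.EllipticCurves.ModularForms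
  Literature.NumberTheory.EllipticCurves.Rank1Residual Literature.NumberTheory.GaloisRepresentations
  Summit.BirchSwinnertonDyer.Rank1Residual Summit.BirchSwinnertonDyer.Rank1Residual.Additive
  Summit.BirchSwinnertonDyer.Rank1Residual.O5

/-! ## §1 An oriented Heegner point realises `P(1)` of every conductor-one datum; the bottom class read on it -/

section Bottom

-- `K : Type`: the tree's ring-class class field theory is universe `0` (as in the crux).
variable (W : WeierstrassCurve ℚ) [W.IsElliptic] [W.IsGloballyMinimal] [NeZero (W.conductorNorm ℤ)]
  (p : ℕ) [hp : Fact p.Prime] (K : Type) [Field K] [NumberField K]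
  (Dt : ModularParametrizationData W (W.conductorNorm ℤ)) (β : ℤ) (ι : K →+* ℂ)

omit [W.IsGloballyMinimal] hp in
/-- **An ORIENTED Heegner point maps to `P(1)`.**  For `K` imaginary quadratic with the Heegner hypothesis for `N_E`, a conductor-one
Kolyvagin–Heegner datum `d` on the frame `(Dt, β, ι)`, a Heegner datum `H` of level `N_E` and discriminant `d_K` WITH THE FRAME'S ORIENTATION
(`β(H) = β`), and a point `y ∈ E(K)` with `ι(y) = heegnerPointComplex Dt H`: the image of `y` in `E(K[1])` is `P(1) = Σ_{s ∈ S} s·y(1)`.  Proof: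
`P(1)` is `Gal(K[1]/K)`-fixed, so it is the image of some `y₀ ∈ E(K)` (McCallum's descent, `McCallum1991.exists_map_eq_derivedPoint_one'`); by Shimura
reciprocity at conductor one (Darmon Thm. 3.7, the tree's PROVED `heegnerPointOfConductor_one_galoisConj_holds`) the conjugates `s·y(1)`, `s ∈ S`, are
the points `φ(τ_Q)`, `Q ∈ H.reps`, so `ι(y₀) = Σ_Q φ(τ_Q) = heegnerPointComplex Dt H = ι(y)`; and `E(K) → E(ℂ)` is injective.
[cite: GrossLMS1991, §4 (P_1 = Tr y_1 = y_K)] [cite: Darmon2004, Thm. 3.7] [cite: McCallumLMS1991, §5 Lemma 5.1] -/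
theorem map_algebraMap_eq_derivedPoint_of_heegnerPoint (hK : IsImaginaryQuadratic K)
    (hH : SatisfiesHeegnerHypothesis (W.conductorNorm ℤ) K) (d : KolyvaginHeegnerData Dt β ι 1)
    (H : HeegnerDatum (W.conductorNorm ℤ) (NumberField.discr K)) (hHβ : H.β = β)
    (y : (W.baseChange K).toAffine.Point)
    (hy : WeierstrassCurve.Affine.Point.map ι.toRatAlgHom y = heegnerPointComplex Dt H) :
    WeierstrassCurve.Affine.Point.map (W' := W) (algebraMap K (ringClassField K ι 1)).toRatAlgHom y = d.derivedPoint := by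
  obtain ⟨y₀, hy₀⟩ := McCallum1991.exists_map_eq_derivedPoint_one' hK d
  obtain ⟨e, he⟩ := heegnerPointOfConductor_one_galoisConj_holds (W.conductorNorm ℤ) W K hK hH Dt β ι d H hHβ
  have hι : ι.toRatAlgHom = (ringClassField K ι 1).subtype.toRatAlgHom.comp
      (algebraMap K (ringClassField K ι 1)).toRatAlgHom := by
    ext x
    rfl
  have hy₀C : WeierstrassCurve.Affine.Point.map ι.toRatAlgHom y₀ = heegnerPointComplex Dt H := by
    rw [hι, ← WeierstrassCurve.Affine.Point.map_map, hy₀, d.derivedPoint_one, map_sum,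
      heegnerPointComplex, ← Finset.sum_coe_sort H.reps, ← Finset.sum_coe_sort d.S]
    exact Fintype.sum_equiv e _ _ fun s ↦ he s
  have hyy₀ : y = y₀ :=
    WeierstrassCurve.Affine.Point.map_injective (W' := W) ι.toRatAlgHom (hy.trans hy₀C.symm)
  rw [hyy₀, hy₀]

/-- **`c(1) ≠ 0 ↔ y ∉ p·E(K)` for an oriented Heegner point `y`.**  On the crux's frames (`p ≥ 5`, `ρ̄_{E,p}` onto, `K` imaginary quadratic,
`d_K < −4`, the Heegner hypothesis for `N_E`): for EVERY conductor-one Kolyvagin–Heegner datum `d` on `(Dt, β, ι)`, every Heegner datum `H` with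
`β(H) = β` and every `y ∈ E(K)` over `heegnerPointComplex Dt H`, the bottom class `c(1) = d.kolyvaginClass _ 1 ∈ H¹(K, E[p])` is non-zero iff
`y` is not `p`-divisible in `E(K)` (§1's realisation + McCallum Cor. 4.5 ∕ Lemma 5.1 with Gross's Lemma 4.3 and Prop. 3.6 supplied, the tree's
`kolyvaginClass_one_ne_zero_iff_not_exists_zsmul_eq`).  The GLOBAL SELF-CERTIFICATE is thus EQUIVALENT to the bottom case of Kolyvagin's
conjecture mod `p` at the frame.  No named fact.  [cite: McCallumLMS1991, Cor. 4.5, §5 Lemma 5.1] [cite: GrossLMS1991, Lemma 4.3, Prop. 3.6, §4 (4.4)] -/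
theorem kolyvaginClass_one_ne_zero_iff_heegnerPoint_not_pDiv (hp5 : 5 ≤ p) (hs : W.HasSurjectiveModNGaloisRep p)
    (hK : IsImaginaryQuadratic K) (hlt : NumberField.discr K < -4)
    (hH : SatisfiesHeegnerHypothesis (W.conductorNorm ℤ) K) (d : KolyvaginHeegnerData Dt β ι 1)
    (H : HeegnerDatum (W.conductorNorm ℤ) (NumberField.discr K)) (hHβ : H.β = β)
    (y : (W.baseChange K).toAffine.Point)
    (hy : WeierstrassCurve.Affine.Point.map ι.toRatAlgHom y = heegnerPointComplex Dt H) :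
    d.kolyvaginClass hp.out 1 ≠ 0 ↔ ¬ ∃ Q : (W.baseChange K).toAffine.Point, (p : ℤ) • Q = y :=
  kolyvaginClass_one_ne_zero_iff_not_exists_zsmul_eq W p K Dt β ι hp5 hs hK hlt hH d y
    (map_algebraMap_eq_derivedPoint_of_heegnerPoint W K Dt β ι hK hH d H hHβ y hy)

end Bottom

/-! ## §2 The self-certificate door: `E`'s own Heegner point, not `p`-divisible in `E(ℚ_p)`, gives `c(1) ≠ 0` — no named fact -/

section SelfCertificate

variable (W : WeierstrassCurve ℚ) [W.IsElliptic] [W.IsGloballyMinimal] (p : ℕ) [hp : Fact p.Prime]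
  {K : Type} [Field K] [NumberField K]

omit [W.IsElliptic] [W.IsGloballyMinimal] in
/-- **Local non-divisibility ⟹ global non-divisibility.**  If the image `y_ι ∈ E(ℚ_p)` of `y ∈ E(K)` along `ι : K →+* ℚ_p` is not `p·Q` for any
`Q ∈ E(ℚ_p)`, then `y` is not `p·Q` for any `Q ∈ E(K)` (`E(K) → E(ℚ_p)` is a group homomorphism). [folklore] -/
theorem not_exists_zsmul_eq_of_selfCertificate (ι : K →+* ℚ_[p]) {y : (W.baseChange K).toAffine.Point}
    (hcert : ¬ ∃ Q : (W.baseChange ℚ_[p]).toAffine.Point, (p : ℤ) • Q = X11b.padicPointOf W p ι y) :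
    ¬ ∃ Q : (W.baseChange K).toAffine.Point, (p : ℤ) • Q = y := by
  rintro ⟨Q, hQ⟩
  refine hcert ⟨X11b.padicPointOf W p ι Q, ?_⟩
  simp only [X11b.padicPointOf, ← hQ, map_zsmul]

/-- **The valuation form of the self-certificate ⟹ the local form, at an ADDITIVE `p ≥ 5`.**  If `y ∈ E(K)` has infinite order and
`ord_p log_ω y ≤ 0` along `ι` (Néron `ℤ_p`-linear logarithm; it is `≥ 0` automatically, `log_ω(E(ℚ_p)) ⊆ ℤ_p` as `p ∤ c_p ≤ 4`), then `y_ι` is not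
`p`-divisible in `E(ℚ_p)`: `y_ι = p·Q` would give `log_ω y_ι = p · log_ω Q` with `log_ω Q ∈ ℤ_p ∖ {0}`, so `ord_p ≥ 1`.  (The local form of
`one_le_padicLogOrd_of_zsmul_eq`; this is exactly the bit Kriz–Li's congruence transports.)  No named fact.
[cite: SilvermanAEC2009, IV.6.4, VII.6.3] [cite: Kim2022StructureSelmer, Lemma 3.10] -/
theorem selfCertificate_of_padicLogOrd_le_zero (hp5 : 5 ≤ p) (hadd : Addv W p) (ι : K →+* ℚ_[p])
    {y : (W.baseChange K).toAffine.Point} (hy : ¬ IsOfFinAddOrder y) (hle : padicLogOrd W p ι y ≤ 0) :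
    ¬ ∃ Q : (W.baseChange ℚ_[p]).toAffine.Point, (p : ℤ) • Q = X11b.padicPointOf W p ι y := by
  rintro ⟨Q, hQ⟩
  have hPι : ¬ IsOfFinAddOrder (X11b.padicPointOf W p ι y) :=
    HeegnerLogTransport.not_isOfFinAddOrder_padicPointOf W p ι y hy
  have hQι : ¬ IsOfFinAddOrder Q := by
    intro h
    apply hPι
    rw [← hQ]
    exact h.zsmul
  have hL : LocalLog.padicLog (W.baseChange ℚ_[p]) Q ≠ 0 :=
    fun h ↦ hQι ((LocalLog.padicLog_eq_zero_iff _ _).mp h)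
  have hval : 0 ≤ (LocalLog.padicLog (W.baseChange ℚ_[p]) Q).valuation :=
    (Padic.norm_le_one_iff_val_nonneg _).mp (norm_padicLog_le_one_of_addv W p hp5 hadd _)
  have hpq : ((p : ℤ) : ℚ_[p]) ≠ 0 := by exact_mod_cast hp.out.ne_zero
  have hX : padicLogOrd W p ι y = X11b.padicLogOrd W p ι y := rfl
  rw [hX, LocalLog.padicLogOrd_eq_valuation_padicLog W p ι y hPι, ← hQ, map_zsmul, zsmul_eq_mul,
    Padic.valuation_mul hpq hL, Int.cast_natCast, Padic.valuation_p] at hle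
  omega

-- `K : Type`: the tree's ring-class class field theory is universe `0` (as in the crux).
variable [NeZero (W.conductorNorm ℤ)] (K : Type) [Field K] [NumberField K]
  (Dt : ModularParametrizationData W (W.conductorNorm ℤ)) (β : ℤ) (ι : K →+* ℂ)

/-- **THE SELF-CERTIFICATE DOOR at conductor one.**  On the crux's frames (`p ≥ 5`, `ρ̄_{E,p}` onto, `K` imaginary quadratic, `d_K < −4`, the
Heegner hypothesis for `N_E`): if SOME Heegner point `y ∈ E(K)` over `heegnerPointComplex Dt H` with `β(H) = β` is not `p`-divisible in `E(ℚ_p)`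
along some `ιp : K →+* ℚ_p` — the certificate v12 asks of the AVATAR, asked of `E` itself — then `c_E(1) ≠ 0` for EVERY conductor-one
Kolyvagin–Heegner datum on `(Dt, β, ι)`.  No Kriz–Li, no avatar, no PUB ∕ DUAL: NO named fact.
[cite: McCallumLMS1991, Cor. 4.5, §5 Lemma 5.1] [cite: GrossLMS1991, §4 (4.4)] -/
theorem kolyvaginClass_one_ne_zero_of_selfCertificate (hp5 : 5 ≤ p) (hs : W.HasSurjectiveModNGaloisRep p)
    (hK : IsImaginaryQuadratic K) (hlt : NumberField.discr K < -4)
    (hH : SatisfiesHeegnerHypothesis (W.conductorNorm ℤ) K)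
    (hcert : ∃ (ιp : K →+* ℚ_[p]) (H : HeegnerDatum (W.conductorNorm ℤ) (NumberField.discr K))
      (y : (W.baseChange K).toAffine.Point), H.β = β ∧
      WeierstrassCurve.Affine.Point.map ι.toRatAlgHom y = heegnerPointComplex Dt H ∧
        ¬ ∃ Q : (W.baseChange ℚ_[p]).toAffine.Point, (p : ℤ) • Q = X11b.padicPointOf W p ιp y)
    (d : KolyvaginHeegnerData Dt β ι 1) :
    d.kolyvaginClass hp.out 1 ≠ 0 := by
  obtain ⟨ιp, H, y, hHβ, hy, hloc⟩ := hcert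
  exact (kolyvaginClass_one_ne_zero_iff_heegnerPoint_not_pDiv W p K Dt β ι hp5 hs hK hlt hH d H hHβ y hy).mpr
    (not_exists_zsmul_eq_of_selfCertificate W p ιp hloc)

/-- **KPA′'s conclusion at a self-certified frame** — the binders of crux r2 `KolyvaginPrimitiveAdditive` (item stmt-BirchSwinnertonDyer-21400)
VERBATIM, plus the self-certificate: some Kolyvagin–Heegner datum of Kolyvagin-prime support — here of conductor `n = 1` (`kolSupp_one`; a datum
exists by Darmon Thm. 3.6, `nonempty_kolyvaginHeegnerData_one`) — has `c(1) ≠ 0` in `H¹(K, E[p])`.  Only `p ≥ 5`, `ρ̄` onto, `K` imaginary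
quadratic, `d_K < −4`, Heegner, `4N ∣ β² − d_K` are used; the other ♯ binders (underscored) are carried for the shape.  NO named fact.
[cite: McCallumLMS1991, Cor. 4.5] [cite: GrossLMS1991, §4 (4.4)] [cite: Darmon2004, Thm. 3.6] -/
theorem kolyvaginPrimitiveAdditive_conclusion_of_selfCertificate (hp5 : 5 ≤ p) (_hadd : Addv W p)
    (hs : W.HasSurjectiveModNGaloisRep p)
    (_hsp : ∀ (ℓ : ℕ) [Fact ℓ.Prime], W.HasMultiplicativeReductionAtPrime ℓ → ¬ p ∣ padicValInt ℓ W.minimalDiscriminantInt)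
    (_htwo : ∃ (ℓ₁ ℓ₂ : ℕ) (_ : Fact ℓ₁.Prime) (_ : Fact ℓ₂.Prime), ℓ₁ ≠ ℓ₂ ∧
      W.HasMultiplicativeReductionAtPrime ℓ₁ ∧ W.HasMultiplicativeReductionAtPrime ℓ₂)
    (_htam : ¬ p ∣ W.tamagawaProduct) (_hr : W.analyticRank = 1) (hK : IsImaginaryQuadratic K)
    (_hodd : Odd (NumberField.discr K)) (hlt : NumberField.discr K < -4)
    (hH : SatisfiesHeegnerHypothesis (W.conductorNorm ℤ) K)
    (_hL : (W.quadraticTwist (NumberField.discr K : ℚ)).entireLFunction 1 ≠ 0)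
    (hβ : (4 * (W.conductorNorm ℤ : ℤ)) ∣ β ^ 2 - NumberField.discr K) (_hc : ¬ (p : ℤ) ∣ Dt.c)
    (hcert : ∃ (ιp : K →+* ℚ_[p]) (H : HeegnerDatum (W.conductorNorm ℤ) (NumberField.discr K))
      (y : (W.baseChange K).toAffine.Point), H.β = β ∧
      WeierstrassCurve.Affine.Point.map ι.toRatAlgHom y = heegnerPointComplex Dt H ∧
        ¬ ∃ Q : (W.baseChange ℚ_[p]).toAffine.Point, (p : ℤ) • Q = X11b.padicPointOf W p ιp y) :
    ∃ (n : ℕ) (d : KolyvaginHeegnerData Dt β ι n),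
      KolyvaginDescent.KolSupp (Zhang2014.IsKolyvaginPrime (W.conductorNorm ℤ) W K p) n ∧
        d.kolyvaginClass (Fact.out : p.Prime) 1 ≠ 0 := by
  obtain ⟨d⟩ := nonempty_kolyvaginHeegnerData_one W K Dt β ι hK hβ
  exact ⟨1, d, KolyvaginDescent.kolSupp_one _,
    kolyvaginClass_one_ne_zero_of_selfCertificate W p K Dt β ι hp5 hs hK hlt hH hcert d⟩

omit [W.IsElliptic] in
/-- **The trivial door: a non-zero BOTTOM class is a witness of KPA′'s conclusion at the frame** (`n = 1`, `kolSupp_one`).  Pure logic; recorded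
because it is the `at-the-bottom` branch of skeleton v13 (part 2, `…KolyvaginPrimitiveAboveBottom` §4).  [cite: GrossLMS1991, §3 (n square-free; n = 1)] -/
theorem kolyvaginPrimitiveAdditive_conclusion_of_bottom
    (h : ∃ d₁ : KolyvaginHeegnerData Dt β ι 1, d₁.kolyvaginClass hp.out 1 ≠ 0) :
    ∃ (n : ℕ) (d : KolyvaginHeegnerData Dt β ι n),
      KolyvaginDescent.KolSupp (Zhang2014.IsKolyvaginPrime (W.conductorNorm ℤ) W K p) n ∧
        d.kolyvaginClass (Fact.out : p.Prime) 1 ≠ 0 := by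
  obtain ⟨d₁, hd₁⟩ := h
  exact ⟨1, d₁, KolyvaginDescent.kolSupp_one _, hd₁⟩

end SelfCertificate

/-! ## §3 The avatar door opens no frame the bottom class does not: slim good-avatar locus ∧ KL ⟹ the global self-certificate -/

section Avatar

variable (W : WeierstrassCurve ℚ) [W.IsElliptic] [W.IsGloballyMinimal] [NeZero (W.conductorNorm ℤ)]
  (p : ℕ) [hp : Fact p.Prime] (K : Type) [Field K] [NumberField K]
  (Dt : ModularParametrizationData W (W.conductorNorm ℤ)) (β : ℤ) (ι : K →+* ℂ)

/-- **On the slim good-avatar locus every oriented Heegner point of `E` is NOT `p`-divisible in `E(K)`** (granted Kriz–Li Thm. 1.16 BY NAME).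
Frame: `E = W` ADDITIVE at `p ≥ 5`, `ρ̄_{E,p}` onto, `K` imaginary quadratic with `d_K < −4`, Heegner for `N_E`, `4N_E ∣ β² − d_K`,
`p ∤ c(Dt)`; the locus clause is v12's VERBATIM (good non-anomalous avatar `E₀` with a `Γ_ℚ`-equivariant `E[p] ≃ E₀[p]`, ♠(1) for `E₀`,
`rad(pN) = rad(pN₀)`, same multiplicative primes, Heegner for `N₀`, `p ∤ c(Dt₀)`, log certificate along `ιp`).  Proof: w3's conductor-one transfer
`kolyvaginClass_one_ne_zero_of_thm116_of_lossless` (sign agreement at the multiplicative primes automatic, `sign_agreement_of_torsionCongr`; the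
depletion-prime units `hdep_of_sign`; `p` split in `K` from `p ∣ N_E` + Heegner) gives `c(1) ≠ 0` for a conductor-one datum (one exists, Darmon Thm. 3.6),
and §1 reads that as `y ∉ p·E(K)`.  READING: the avatar's certificate, transported by Kriz–Li, IS the global self-certificate — v12's covered locus
lies inside {`c(1) ≠ 0`}, the frames the bottom class certifies by itself (§1) with NO named fact.  CONDITIONAL on `hKL`.
[cite: KrizLi2019, Thm. 1.16, Rem. 1.17] [cite: McCallumLMS1991, Cor. 4.5, Lemma 5.1] [cite: DarmonDiamondTaylor1995, Prop. 2.12 (c)] -/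
theorem heegnerPoint_not_pDiv_on_goodAvatarLocus_of_thm116 (hKL : KrizLi2019.thm116_padicLogHeegner_congruence)
    (hp5 : 5 ≤ p) (hadd : Addv W p) (hs : W.HasSurjectiveModNGaloisRep p)
    (hK : IsImaginaryQuadratic K) (hlt : NumberField.discr K < -4)
    (hH : SatisfiesHeegnerHypothesis (W.conductorNorm ℤ) K)
    (hβ : (4 * (W.conductorNorm ℤ : ℤ)) ∣ β ^ 2 - NumberField.discr K) (hc : ¬ (p : ℤ) ∣ Dt.c)
    (hav : ∃ (W₀ : WeierstrassCurve ℚ) (_ : W₀.IsElliptic) (_ : W₀.IsGloballyMinimal) (_ : NeZero (W₀.conductorNorm ℤ))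
      (Dt₀ : ModularParametrizationData W₀ (W₀.conductorNorm ℤ)) (e : geomTorsion W (p : ℤ) ≃+ geomTorsion W₀ (p : ℤ)),
      (∀ (σ : absoluteGaloisGroup ℚ) (P : geomTorsion W (p : ℤ)), e (σ • P) = σ • e P) ∧
      W₀.HasGoodReductionAtPrime p ∧ ¬ (p : ℤ) ∣ W₀.frobeniusTrace p - 1 ∧
      (∀ (ℓ : ℕ) [Fact ℓ.Prime], W₀.HasMultiplicativeReductionAtPrime ℓ →
        ¬ p ∣ padicValInt ℓ W₀.minimalDiscriminantInt) ∧
      (∀ q : ℕ, q.Prime → (q ∣ p * W.conductorNorm ℤ ↔ q ∣ p * W₀.conductorNorm ℤ)) ∧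
      (∀ (ℓ : ℕ) [Fact ℓ.Prime], W.HasMultiplicativeReductionAtPrime ℓ ↔ W₀.HasMultiplicativeReductionAtPrime ℓ) ∧
      SatisfiesHeegnerHypothesis (W₀.conductorNorm ℤ) K ∧ ¬ (p : ℤ) ∣ Dt₀.c ∧
      ∃ (ιp : K →+* ℚ_[p]) (H₀ : HeegnerDatum (W₀.conductorNorm ℤ) (NumberField.discr K))
        (y₀ : (W₀.baseChange K).toAffine.Point),
        WeierstrassCurve.Affine.Point.map ι.toRatAlgHom y₀ = heegnerPointComplex Dt₀ H₀ ∧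
          ¬ ∃ Q : (W₀.baseChange ℚ_[p]).toAffine.Point, (p : ℤ) • Q = X11b.padicPointOf W₀ p ιp y₀)
    (H : HeegnerDatum (W.conductorNorm ℤ) (NumberField.discr K)) (hHβ : H.β = β)
    (y : (W.baseChange K).toAffine.Point)
    (hy : WeierstrassCurve.Affine.Point.map ι.toRatAlgHom y = heegnerPointComplex Dt H) :
    ¬ ∃ Q : (W.baseChange K).toAffine.Point, (p : ℤ) • Q = y := by
  obtain ⟨W₀, _, _, _, Dt₀, e, he, hgood₀, hna, hsp₀, hrad, htype, hH₀, hc₀, ιp, hcert⟩ := hav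
  -- `p` splits in `K`: `p ∣ N_E` (additive reduction) and `K` is Heegner for `N_E`
  have hsplit : ((Ideal.span {(p : ℤ)}).primesOver (𝓞 K)).ncard = 2 :=
    hH p hp.out ((W.dvd_conductorNorm_iff_not_hasGoodReductionAtPrime p).mpr hadd.1)
  -- sign agreement at the multiplicative primes is automatic (Tate curve + torsion congruence)
  have hsign : ∀ (ℓ : ℕ) [Fact ℓ.Prime], W₀.HasMultiplicativeReductionAtPrime ℓ → W.LFunction ℓ = W₀.LFunction ℓ :=
    sign_agreement_of_torsionCongr W W₀ p hp5 hadd hsp₀ htype e he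
  obtain ⟨d⟩ := nonempty_kolyvaginHeegnerData_one W K Dt β ι hK hβ
  have hd : d.kolyvaginClass hp.out 1 ≠ 0 :=
    kolyvaginClass_one_ne_zero_of_thm116_of_lossless W p K Dt β ι hKL hp5 hadd hs hK hlt hH hc W₀ e he hgood₀ hna
      (hdep_of_sign W W₀ p hrad htype hsign) Dt₀ hc₀ hH₀ hsplit ιp hcert d
  exact (kolyvaginClass_one_ne_zero_iff_heegnerPoint_not_pDiv W p K Dt β ι hp5 hs hK hlt hH d H hHβ y hy).mp hd

end Avatar

end Summit.BirchSwinnertonDyer.BirchSwinnertonDyer.Theorems.AdditiveKoly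

end
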